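import Literature.AlgebraicGeometry.Resolution.Kuhlmann2019HenselianRationalityFiniteRankAssembly
import Literature.AlgebraicGeometry.Resolution.SeparablyDefectlessRationalRTProofs
import Literature.AlgebraicGeometry.Resolution.KuhlmannVlahuThm111
import HarnessLib

/-!
# Henselian rationality in finite rank (Kuhlmann 2019, Prop. 5.6): what its discharge now rests on

Topic: `Literature/AlgebraicGeometry/Resolution` (valued function fields). Bookkeeping layer for
the named fact `Kuhlmann2019_Prop56_sepClosed` (`Kuhlmann2019HenselianRationalitySteps.lean`) =
F.-V. Kuhlmann, *Elimination of ramification II: Henselian rationality*, Israel J. Math. 234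
(2019) 927–958 = arXiv:1701.05508, **Prop. 5.6** (p. 13 of the arXiv version):

> **Proposition 5.6.** Every immediate separable function field `(F|K, v)` of transcendence
> degree 1 over a separably tame field `(K, v)` of finite rank is henselian rational.

vendored for a separably closed ground field `K` (a separably tame field).

The tree PROVES Prop. 5.6 by induction on the rank
(`Kuhlmann2019HenselianRationalityFiniteRankProofs.lean`, Hensel-root rendering of the printed
composite-place argument) from three printed ingredients —
`Kuhlmann2019_Prop56_sepClosed.of_prop52 : Kuhlmann2019_Prop52_sepClosed →
Kuhlmann2010SeparablyDefectlessRationalRT_sepClosed → Kuhlmann2019_Lemma54 →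
Kuhlmann2019_Prop56_sepClosed` — of which Lemma 5.4 was fed in by
`Kuhlmann2019_Prop56_sepClosed.of_prop52_of_sepDefectlessRT`
(`Kuhlmann2019HenselianRationalityFiniteRankAssembly.lean`, using `Kuhlmann2019_Lemma54_holds`).
The second ingredient, [16, Thm. 1] = Kuhlmann 2010, Thm. 1.1, "separably defectless" clause for
`K(x)` with a residue-transcendental generator over a separably closed `K`, has since been
DISCHARGED: `Kuhlmann2010SeparablyDefectlessRationalRT_sepClosed_holds`
(`SeparablyDefectlessRationalRTProofs.lean`). This file feeds it in, so that Prop. 5.6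
(separably closed `K`, finite rank) now rests on exactly ONE named fact,

* `Kuhlmann2019_Prop52_sepClosed` — Prop. 5.2 (p. 12: "Every immediate separable function
  field `(F|K, v)` of transcendence degree 1 over a separable-algebraically closed field
  `(K, v)` of rank 1 is henselian rational"),

which the tree in turn reduces (`Kuhlmann2019_Prop52_sepClosed.of_degreeP_step`,
`KuhlmannVlahuThm111.lean`: Lemma 5.1, the induction on the tower, and Kuhlmann–Vlahu 2014,
Thm. 11.1, all proved) to the degree-`p` step `(hstep)` = Props. 4.8 / 4.9 of the paper
(p. 11) for a separable-algebraically closed `K` of rank one. Both one-hypothesis reductions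
are recorded here; the discharge `Kuhlmann2019_Prop56_sepClosed_holds` is
`Kuhlmann2019_Prop56_sepClosed.of_prop52_sepClosed Kuhlmann2019_Prop52_sepClosed_holds` once
that lands (append protocol, this file).

## Content (PROVED composition only; no definition, no named fact)

* `Kuhlmann2019_Prop56_sepClosed.of_prop52_sepClosed` — Prop. 5.6 (separably closed `K`,
  finite rank) from Prop. 5.2 ALONE.
* `Kuhlmann2019_Prop56_sepClosed.of_degreeP_step` — hence from `(hstep)` = Props. 4.8 / 4.9
  alone, verbatim as in `Kuhlmann2019_Prop52_sepClosed.of_degreeP_step`: the remaining trust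
  base of `Kuhlmann2019_Prop56_sepClosed_holds` along the printed proofs.

## Sources

* [K19] F.-V. Kuhlmann, Israel J. Math. 234 (2019) = arXiv:1701.05508: Props. 4.8, 4.9
  (p. 11), Prop. 5.2 (p. 12), Lemma 5.4, Prop. 5.6 (p. 13). [Kuhlmann2019]
* [16] = F.-V. Kuhlmann, *Elimination of ramification I: The generalized stability theorem*,
  Trans. AMS 362 (2010) = arXiv:1003.5678: Thm. 1.1. [Kuhlmann2010]
* [23] = F.-V. Kuhlmann, I. Vlahu, Math. Z. 276 (2014) = arXiv:1304.0200: Thm. 11.1.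
-/

noncomputable section

namespace Literature.AlgebraicGeometry.Resolution

universe u

/-- **Kuhlmann 2019, Prop. 5.6 for a separably closed ground field of finite rank
(`Kuhlmann2019_Prop56_sepClosed`), from Prop. 5.2 alone** —
`Kuhlmann2019_Prop56_sepClosed.of_prop52_of_sepDefectlessRT` with the "separably defectless"
clause of [16, Thm. 1] for a residue-transcendental generator discharged by
`Kuhlmann2010SeparablyDefectlessRationalRT_sepClosed_holds` (Lemma 5.4 was already discharged
there by `Kuhlmann2019_Lemma54_holds`). The discharge `Kuhlmann2019_Prop56_sepClosed_holds` is
this theorem applied to `Kuhlmann2019_Prop52_sepClosed_holds`. PROVED.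
[cite: Kuhlmann2019, Prop. 5.6] -/
theorem Kuhlmann2019_Prop56_sepClosed.of_prop52_sepClosed
    (h52 : Kuhlmann2019_Prop52_sepClosed.{u}) : Kuhlmann2019_Prop56_sepClosed.{u} :=
  Kuhlmann2019_Prop56_sepClosed.of_prop52_of_sepDefectlessRT h52
    Kuhlmann2010SeparablyDefectlessRationalRT_sepClosed_holds

/-- **Kuhlmann 2019, Prop. 5.6 (separably closed ground field, finite rank) from the degree-`p`
step `(hstep)` of Prop. 5.2 alone** (`(hstep)` = Props. 4.8 / 4.9 of the paper for a
separable-algebraically closed `K` of rank one: "an immediate transcendental extension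
`(K(x)|K, v)`, and a Galois extension `E` of `K(x)^h` of degree `p`. Then there exists `ϑ ∈ E`
such that `E = K(ϑ)^h`", verbatim as in `Kuhlmann2019_Prop52_sepClosed.of_degreeP_step`, which
supplies Prop. 5.2 from it through Lemma 5.1 and [23, Thm. 11.1], both proved): the remaining
trust base of `Kuhlmann2019_Prop56_sepClosed_holds` along the printed proofs. PROVED.
[cite: Kuhlmann2019, Prop. 5.6 (with Prop. 5.2, Props. 4.8, 4.9)] -/
theorem Kuhlmann2019_Prop56_sepClosed.of_degreeP_step
    (hstep : ∀ (Ω : Type u) [Field Ω] [IsAlgClosed Ω] (V : ValuationSubring Ω) (p : ℕ)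
      [CharP (IsLocalRing.ResidueField V) p], p.Prime → ∀ (K : Subfield Ω) (y : Ω) (E : Subfield Ω),
      IsSepClosed K → IsRankOne V K → Transcendental K y →
      IsImmediateOver V K (Subfield.closure ((K : Set Ω) ∪ {y})) →
      IsGaloisStep p (henselization V (Subfield.closure ((K : Set Ω) ∪ {y}))) E →
      ∃ ϑ ∈ E, E = henselization V (Subfield.closure ((K : Set Ω) ∪ {ϑ}))) :
    Kuhlmann2019_Prop56_sepClosed.{u} :=
  Kuhlmann2019_Prop56_sepClosed.of_prop52_sepClosed
    (Kuhlmann2019_Prop52_sepClosed.of_degreeP_step hstep)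

end Literature.AlgebraicGeometry.Resolution

end
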